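import Summits.NavierStokesRegularity.NavierStokesRegularity.Theorems.SymmetryModuliCountForcedSymmetryClosingDichotomySplit
import HarnessLib

/-!
# Crux `ForcedSymmetry` (stmt-NavierStokesRegularity-4052), line `closing-dichotomy` — the shape of the sensitive part

Support file (`--supports stmt-NavierStokesRegularity-4052`, registered sub-goal `forcedSymmetry_iff_liouvilleParts`; lead c9).
An honesty certificate for the registered research stub `stub_sensitiveClosing` of `Cruxes/ForcedSymmetry/Lines/closing_dichotomy.lean`
(gen c9.3) — the analogue of c4's p140852 for the live line's `2′`.  Its ACCUMULATION conclusion ("`U` is `L³(Q₁)`-approximated by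
origin-centred RDSS classical class profiles") can, in the presence of stmt-8561 (`RDSSLiouvilleInClass`, which the line needs
anyway), only hold VACUOUSLY: under 8561 every such approximant is regular at the origin, hence zero on `t < 0`
(`rdss_vanishes_of_not_singular`), so accumulation at every accuracy forces `‖U‖_{L³(Q₁)} = 0` and `U` regular
(`accumulation_endpoint`), contradicting the stub's singular hypothesis.  Hence, given 8561, the stub is EQUIVALENT to the plain
LIOUVILLE statement

  `SensitiveLiouville` := a slab class profile (suitable weak, weak gradient, `𝐈 < ∞`, rate `C`) that is uniformly
  scaling-recurrent, NOT rotated-discretely self-similar (stmt-8561's clause) and ORBIT-SENSITIVE at itself on `Q(0,1)` is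
  regular at the origin,

and the crux splits into THREE LIOUVILLE THEOREMS with three disjoint single-object refutation targets (sensitive aperiodic hull /
quasi-periodic profile / (R)DSS profile): `ForcedSymmetry ↔ (SensitiveLiouville ∧ AlmostPeriodicLiouville ∧ RDSSLiouvilleInClass)`.
For the planner's `--split` (census v3 §R9/§R11) this is the recommended typing of the sensitive child.

* `sensitiveClosing_of_sensitiveLiouville` — `SensitiveLiouville → SensitiveClosing` (logic: the Liouville statement makes the
  closing stub's hypotheses contradictory).
* `sensitiveLiouville_of_sensitiveClosing` — `RDSSLiouvilleInClass → SensitiveClosing → SensitiveLiouville` (the endpoint argument).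
* `sensitiveClosing_iff_sensitiveLiouville` — `RDSSLiouvilleInClass → (SensitiveClosing ↔ SensitiveLiouville)`.
* `forcedSymmetry_iff_liouvilleParts` — **`ForcedSymmetry ↔ (SensitiveLiouville ∧ AlmostPeriodicLiouville ∧ RDSSLiouvilleInClass)`**.

## References

* D. Albritton, T. Barker, J. Math. Fluid Mech. 21 (2019), Thm 1.1, §3. [AlbrittonBarker2019]
* D. Chae, J. Wolf, arXiv:1610.09464, Thm 1.1/1.3. [ChaeWolf2017RemovingDSS]
* J. Auslander, J. Yorke, Tôhoku Math. J. 32 (1980). [AuslanderYorke1980]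
-/

noncomputable section

-- the sub-problem namespace repeats the summit name (D-0017 layout `Summit.<S>.<P>.Theorems`)
set_option linter.dupNamespace false

open MeasureTheory Set Filter Topology Function

namespace Summit.NavierStokesRegularity.NavierStokesRegularity.Theorems.SymmetryModuliCountForcedSymmetry

open Literature.Analysis.FluidPDE Metric
open scoped ENNReal

/-- **`SensitiveLiouville → SensitiveClosing`** (pure logic): if sensitive aperiodic recurrent class profiles are regular at the
origin, the closing stub's hypotheses (which include a singular origin) are contradictory, so its accumulation conclusion holds
vacuously. [folklore] -/
theorem sensitiveClosing_of_sensitiveLiouville :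
    (∀ (u : ℝ → EuclideanSpace ℝ (Fin 3) → EuclideanSpace ℝ (Fin 3)) (p : ℝ → EuclideanSpace ℝ (Fin 3) → ℝ) (G : ℝ → EuclideanSpace ℝ (Fin 3) → EuclideanSpace ℝ (Fin 3) →L[ℝ] EuclideanSpace ℝ (Fin 3)) (C : ℝ),
       IsSuitableWeakSolutionOn (slab (EuclideanSpace ℝ (Fin 3)) (Set.Iio 0) isOpen_Iio) 1 0 u p →
       HasWeakSpatialGradientOn (slab (EuclideanSpace ℝ (Fin 3)) (Set.Iio 0) isOpen_Iio) u G →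
       typeIBound (Set.Iio (0 : ℝ) ×ˢ Set.univ) u p G < ⊤ →
       HasTypeITimeDecay C u →
       (∀ ε : ℝ, 0 < ε → ∀ K : Set (ℝ × EuclideanSpace ℝ (Fin 3)), IsCompact K → K ⊆ Set.Iic (0 : ℝ) ×ˢ Set.univ →
         ∃ L : ℝ, 0 < L ∧ ∀ a : ℝ, ∃ σ ∈ Set.Icc a (a + L),
           eLpNorm (fun z : ℝ × EuclideanSpace ℝ (Fin 3) => nsRescale (Real.exp σ) u z.1 z.2 - u z.1 z.2) 3
             (volume.restrict K) ≤ ENNReal.ofReal ε) →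
       (¬ ∃ l : ℝ, 1 < l ∧ ∃ (R : EuclideanSpace ℝ (Fin 3) ≃ₗᵢ[ℝ] EuclideanSpace ℝ (Fin 3)) (ξ : EuclideanSpace ℝ (Fin 3)) (τ : ℝ), τ ≤ 0 ∧
           (fun z : ℝ × EuclideanSpace ℝ (Fin 3) => l • R.symm (u (l ^ 2 * z.1 + τ) (l • R z.2 + ξ)))
             =ᵐ[volume.restrict (Set.Iio (0 : ℝ) ×ˢ Set.univ)] (fun z : ℝ × EuclideanSpace ℝ (Fin 3) => u z.1 z.2)) →
       (∃ δ : ℝ, 0 < δ ∧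
         ∀ ε : ℝ, 0 < ε → ∀ K : Set (ℝ × EuclideanSpace ℝ (Fin 3)), IsCompact K → K ⊆ Set.Iic (0 : ℝ) ×ˢ Set.univ →
           ∃ σ : ℝ, eLpNorm (fun z : ℝ × EuclideanSpace ℝ (Fin 3) => nsRescale (Real.exp σ) u z.1 z.2 - u z.1 z.2) 3
               (volume.restrict K) ≤ ENNReal.ofReal ε ∧
             ∃ s : ℝ, ENNReal.ofReal δ < eLpNorm (fun z : ℝ × EuclideanSpace ℝ (Fin 3) =>
                 nsRescale (Real.exp σ) (nsRescale (Real.exp s) u) z.1 z.2 - nsRescale (Real.exp s) u z.1 z.2) 3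
               (volume.restrict (parabolicCylinder 1 (0 : ℝ × EuclideanSpace ℝ (Fin 3))))) →
       ¬ IsBackwardSingularPoint u 0) →
    (∀ (u : ℝ → EuclideanSpace ℝ (Fin 3) → EuclideanSpace ℝ (Fin 3)) (p : ℝ → EuclideanSpace ℝ (Fin 3) → ℝ) (G : ℝ → EuclideanSpace ℝ (Fin 3) → EuclideanSpace ℝ (Fin 3) →L[ℝ] EuclideanSpace ℝ (Fin 3)) (C : ℝ),
       IsSuitableWeakSolutionOn (slab (EuclideanSpace ℝ (Fin 3)) (Set.Iio 0) isOpen_Iio) 1 0 u p →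
       HasWeakSpatialGradientOn (slab (EuclideanSpace ℝ (Fin 3)) (Set.Iio 0) isOpen_Iio) u G →
       typeIBound (Set.Iio (0 : ℝ) ×ˢ Set.univ) u p G < ⊤ →
       HasTypeITimeDecay C u →
       (∀ ε : ℝ, 0 < ε → ∀ K : Set (ℝ × EuclideanSpace ℝ (Fin 3)), IsCompact K → K ⊆ Set.Iic (0 : ℝ) ×ˢ Set.univ →
         ∃ L : ℝ, 0 < L ∧ ∀ a : ℝ, ∃ σ ∈ Set.Icc a (a + L),
           eLpNorm (fun z : ℝ × EuclideanSpace ℝ (Fin 3) => nsRescale (Real.exp σ) u z.1 z.2 - u z.1 z.2) 3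
             (volume.restrict K) ≤ ENNReal.ofReal ε) →
       IsBackwardSingularPoint u 0 →
       (¬ ∃ l : ℝ, 1 < l ∧ ∃ (R : EuclideanSpace ℝ (Fin 3) ≃ₗᵢ[ℝ] EuclideanSpace ℝ (Fin 3)) (ξ : EuclideanSpace ℝ (Fin 3)) (τ : ℝ), τ ≤ 0 ∧
           (fun z : ℝ × EuclideanSpace ℝ (Fin 3) => l • R.symm (u (l ^ 2 * z.1 + τ) (l • R z.2 + ξ)))
             =ᵐ[volume.restrict (Set.Iio (0 : ℝ) ×ˢ Set.univ)] (fun z : ℝ × EuclideanSpace ℝ (Fin 3) => u z.1 z.2)) →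
       (∃ δ : ℝ, 0 < δ ∧
         ∀ ε : ℝ, 0 < ε → ∀ K : Set (ℝ × EuclideanSpace ℝ (Fin 3)), IsCompact K → K ⊆ Set.Iic (0 : ℝ) ×ˢ Set.univ →
           ∃ σ : ℝ, eLpNorm (fun z : ℝ × EuclideanSpace ℝ (Fin 3) => nsRescale (Real.exp σ) u z.1 z.2 - u z.1 z.2) 3
               (volume.restrict K) ≤ ENNReal.ofReal ε ∧
             ∃ s : ℝ, ENNReal.ofReal δ < eLpNorm (fun z : ℝ × EuclideanSpace ℝ (Fin 3) =>
                 nsRescale (Real.exp σ) (nsRescale (Real.exp s) u) z.1 z.2 - nsRescale (Real.exp s) u z.1 z.2) 3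
               (volume.restrict (parabolicCylinder 1 (0 : ℝ × EuclideanSpace ℝ (Fin 3))))) →
       ∀ ε : ℝ, 0 < ε →
         ∃ (w : ℝ → EuclideanSpace ℝ (Fin 3) → EuclideanSpace ℝ (Fin 3)) (q : ℝ → EuclideanSpace ℝ (Fin 3) → ℝ) (H : ℝ → EuclideanSpace ℝ (Fin 3) → EuclideanSpace ℝ (Fin 3) →L[ℝ] EuclideanSpace ℝ (Fin 3)) (C' : ℝ),
           IsSuitableWeakSolutionOn (slab (EuclideanSpace ℝ (Fin 3)) (Set.Iio 0) isOpen_Iio) 1 0 w q ∧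
           HasWeakSpatialGradientOn (slab (EuclideanSpace ℝ (Fin 3)) (Set.Iio 0) isOpen_Iio) w H ∧
           typeIBound (Set.Iio (0 : ℝ) ×ˢ Set.univ) w q H < ⊤ ∧
           HasTypeITimeDecay C' w ∧
           IsClassicalNSSolutionOn (Set.Iio 0) 1 0 w q ∧
           (∃ l : ℝ, 1 < l ∧ ∃ R : EuclideanSpace ℝ (Fin 3) ≃ₗᵢ[ℝ] EuclideanSpace ℝ (Fin 3),
             (fun z : ℝ × EuclideanSpace ℝ (Fin 3) => l • R.symm (w (l ^ 2 * z.1) (l • R z.2)))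
               =ᵐ[volume.restrict (Set.Iio (0 : ℝ) ×ˢ Set.univ)] (fun z : ℝ × EuclideanSpace ℝ (Fin 3) => w z.1 z.2)) ∧
           eLpNorm (fun z : ℝ × EuclideanSpace ℝ (Fin 3) => w z.1 z.2 - u z.1 z.2) 3
             (volume.restrict (parabolicCylinder 1 (0 : ℝ × EuclideanSpace ℝ (Fin 3)))) ≤ ENNReal.ofReal ε) := by
  intro hSL u p G C hsw hwg hI hdec hrec hsing hper hsens
  exact absurd hsing (hSL u p G C hsw hwg hI hdec hrec hper hsens)

/-- **`RDSSLiouvilleInClass → SensitiveClosing → SensitiveLiouville`** (the endpoint argument of the line's composition): under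
stmt-8561 every origin-centred RDSS classical class profile is regular at the origin, hence zero on `t < 0`
(`rdss_vanishes_of_not_singular`); so the accumulation delivered by the closing stub at accuracy `1/(n+1)` for every `n` gives
`‖U‖_{L³(Q₁)} ≤ 1/(n+1)`, and `U` is regular (`accumulation_endpoint`). [cite: ChaeWolf2017RemovingDSS, proof of Thm 1.3; AlbrittonBarker2019, §3] -/
theorem sensitiveLiouville_of_sensitiveClosing :
    Summit.NavierStokesRegularity.NavierStokesRegularity.Theses.DulacContraction.RDSSLiouvilleInClass →
    (∀ (u : ℝ → EuclideanSpace ℝ (Fin 3) → EuclideanSpace ℝ (Fin 3)) (p : ℝ → EuclideanSpace ℝ (Fin 3) → ℝ) (G : ℝ → EuclideanSpace ℝ (Fin 3) → EuclideanSpace ℝ (Fin 3) →L[ℝ] EuclideanSpace ℝ (Fin 3)) (C : ℝ),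
       IsSuitableWeakSolutionOn (slab (EuclideanSpace ℝ (Fin 3)) (Set.Iio 0) isOpen_Iio) 1 0 u p →
       HasWeakSpatialGradientOn (slab (EuclideanSpace ℝ (Fin 3)) (Set.Iio 0) isOpen_Iio) u G →
       typeIBound (Set.Iio (0 : ℝ) ×ˢ Set.univ) u p G < ⊤ →
       HasTypeITimeDecay C u →
       (∀ ε : ℝ, 0 < ε → ∀ K : Set (ℝ × EuclideanSpace ℝ (Fin 3)), IsCompact K → K ⊆ Set.Iic (0 : ℝ) ×ˢ Set.univ →
         ∃ L : ℝ, 0 < L ∧ ∀ a : ℝ, ∃ σ ∈ Set.Icc a (a + L),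
           eLpNorm (fun z : ℝ × EuclideanSpace ℝ (Fin 3) => nsRescale (Real.exp σ) u z.1 z.2 - u z.1 z.2) 3
             (volume.restrict K) ≤ ENNReal.ofReal ε) →
       IsBackwardSingularPoint u 0 →
       (¬ ∃ l : ℝ, 1 < l ∧ ∃ (R : EuclideanSpace ℝ (Fin 3) ≃ₗᵢ[ℝ] EuclideanSpace ℝ (Fin 3)) (ξ : EuclideanSpace ℝ (Fin 3)) (τ : ℝ), τ ≤ 0 ∧
           (fun z : ℝ × EuclideanSpace ℝ (Fin 3) => l • R.symm (u (l ^ 2 * z.1 + τ) (l • R z.2 + ξ)))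
             =ᵐ[volume.restrict (Set.Iio (0 : ℝ) ×ˢ Set.univ)] (fun z : ℝ × EuclideanSpace ℝ (Fin 3) => u z.1 z.2)) →
       (∃ δ : ℝ, 0 < δ ∧
         ∀ ε : ℝ, 0 < ε → ∀ K : Set (ℝ × EuclideanSpace ℝ (Fin 3)), IsCompact K → K ⊆ Set.Iic (0 : ℝ) ×ˢ Set.univ →
           ∃ σ : ℝ, eLpNorm (fun z : ℝ × EuclideanSpace ℝ (Fin 3) => nsRescale (Real.exp σ) u z.1 z.2 - u z.1 z.2) 3
               (volume.restrict K) ≤ ENNReal.ofReal ε ∧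
             ∃ s : ℝ, ENNReal.ofReal δ < eLpNorm (fun z : ℝ × EuclideanSpace ℝ (Fin 3) =>
                 nsRescale (Real.exp σ) (nsRescale (Real.exp s) u) z.1 z.2 - nsRescale (Real.exp s) u z.1 z.2) 3
               (volume.restrict (parabolicCylinder 1 (0 : ℝ × EuclideanSpace ℝ (Fin 3))))) →
       ∀ ε : ℝ, 0 < ε →
         ∃ (w : ℝ → EuclideanSpace ℝ (Fin 3) → EuclideanSpace ℝ (Fin 3)) (q : ℝ → EuclideanSpace ℝ (Fin 3) → ℝ) (H : ℝ → EuclideanSpace ℝ (Fin 3) → EuclideanSpace ℝ (Fin 3) →L[ℝ] EuclideanSpace ℝ (Fin 3)) (C' : ℝ),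
           IsSuitableWeakSolutionOn (slab (EuclideanSpace ℝ (Fin 3)) (Set.Iio 0) isOpen_Iio) 1 0 w q ∧
           HasWeakSpatialGradientOn (slab (EuclideanSpace ℝ (Fin 3)) (Set.Iio 0) isOpen_Iio) w H ∧
           typeIBound (Set.Iio (0 : ℝ) ×ˢ Set.univ) w q H < ⊤ ∧
           HasTypeITimeDecay C' w ∧
           IsClassicalNSSolutionOn (Set.Iio 0) 1 0 w q ∧
           (∃ l : ℝ, 1 < l ∧ ∃ R : EuclideanSpace ℝ (Fin 3) ≃ₗᵢ[ℝ] EuclideanSpace ℝ (Fin 3),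
             (fun z : ℝ × EuclideanSpace ℝ (Fin 3) => l • R.symm (w (l ^ 2 * z.1) (l • R z.2)))
               =ᵐ[volume.restrict (Set.Iio (0 : ℝ) ×ˢ Set.univ)] (fun z : ℝ × EuclideanSpace ℝ (Fin 3) => w z.1 z.2)) ∧
           eLpNorm (fun z : ℝ × EuclideanSpace ℝ (Fin 3) => w z.1 z.2 - u z.1 z.2) 3
             (volume.restrict (parabolicCylinder 1 (0 : ℝ × EuclideanSpace ℝ (Fin 3)))) ≤ ENNReal.ofReal ε) →
    (∀ (u : ℝ → EuclideanSpace ℝ (Fin 3) → EuclideanSpace ℝ (Fin 3)) (p : ℝ → EuclideanSpace ℝ (Fin 3) → ℝ) (G : ℝ → EuclideanSpace ℝ (Fin 3) → EuclideanSpace ℝ (Fin 3) →L[ℝ] EuclideanSpace ℝ (Fin 3)) (C : ℝ),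
       IsSuitableWeakSolutionOn (slab (EuclideanSpace ℝ (Fin 3)) (Set.Iio 0) isOpen_Iio) 1 0 u p →
       HasWeakSpatialGradientOn (slab (EuclideanSpace ℝ (Fin 3)) (Set.Iio 0) isOpen_Iio) u G →
       typeIBound (Set.Iio (0 : ℝ) ×ˢ Set.univ) u p G < ⊤ →
       HasTypeITimeDecay C u →
       (∀ ε : ℝ, 0 < ε → ∀ K : Set (ℝ × EuclideanSpace ℝ (Fin 3)), IsCompact K → K ⊆ Set.Iic (0 : ℝ) ×ˢ Set.univ →
         ∃ L : ℝ, 0 < L ∧ ∀ a : ℝ, ∃ σ ∈ Set.Icc a (a + L),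
           eLpNorm (fun z : ℝ × EuclideanSpace ℝ (Fin 3) => nsRescale (Real.exp σ) u z.1 z.2 - u z.1 z.2) 3
             (volume.restrict K) ≤ ENNReal.ofReal ε) →
       (¬ ∃ l : ℝ, 1 < l ∧ ∃ (R : EuclideanSpace ℝ (Fin 3) ≃ₗᵢ[ℝ] EuclideanSpace ℝ (Fin 3)) (ξ : EuclideanSpace ℝ (Fin 3)) (τ : ℝ), τ ≤ 0 ∧
           (fun z : ℝ × EuclideanSpace ℝ (Fin 3) => l • R.symm (u (l ^ 2 * z.1 + τ) (l • R z.2 + ξ)))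
             =ᵐ[volume.restrict (Set.Iio (0 : ℝ) ×ˢ Set.univ)] (fun z : ℝ × EuclideanSpace ℝ (Fin 3) => u z.1 z.2)) →
       (∃ δ : ℝ, 0 < δ ∧
         ∀ ε : ℝ, 0 < ε → ∀ K : Set (ℝ × EuclideanSpace ℝ (Fin 3)), IsCompact K → K ⊆ Set.Iic (0 : ℝ) ×ˢ Set.univ →
           ∃ σ : ℝ, eLpNorm (fun z : ℝ × EuclideanSpace ℝ (Fin 3) => nsRescale (Real.exp σ) u z.1 z.2 - u z.1 z.2) 3
               (volume.restrict K) ≤ ENNReal.ofReal ε ∧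
             ∃ s : ℝ, ENNReal.ofReal δ < eLpNorm (fun z : ℝ × EuclideanSpace ℝ (Fin 3) =>
                 nsRescale (Real.exp σ) (nsRescale (Real.exp s) u) z.1 z.2 - nsRescale (Real.exp s) u z.1 z.2) 3
               (volume.restrict (parabolicCylinder 1 (0 : ℝ × EuclideanSpace ℝ (Fin 3))))) →
       ¬ IsBackwardSingularPoint u 0) := by
  intro h8561 hSC U P H C hU hH hIU hCU hrecU hper hsens hsingU
  have hacc := hSC U P H C hU hH hIU hCU hrecU hsingU hper hsens
  refine accumulation_endpoint hH hIU (fun n => ?_) hsingU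
  obtain ⟨wn, qn, Hn, Cn, hswn, hwgn, hIn, hdecn, hcln, ⟨l, hl, R, hae⟩, hclose⟩ :=
    hacc (1 / ((n : ℝ) + 1)) (by positivity)
  have hreg : ¬ IsBackwardSingularPoint wn 0 :=
    h8561 wn qn Hn Cn hswn hwgn hIn hdecn hcln ⟨l, hl, R, 0, 0, le_rfl, by simpa only [add_zero] using hae⟩
  have hvan : ∀ t < (0 : ℝ), ∀ x : EuclideanSpace ℝ (Fin 3), wn t x = 0 :=
    rdss_vanishes_of_not_singular hcln hl hae hreg
  have hEq : ∀ z ∈ parabolicCylinder 1 (0 : ℝ × EuclideanSpace ℝ (Fin 3)),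
      (fun z : ℝ × EuclideanSpace ℝ (Fin 3) => wn z.1 z.2 - U z.1 z.2) z =
        (fun z : ℝ × EuclideanSpace ℝ (Fin 3) => -(U z.1 z.2)) z := by
    intro z hz
    have hz' := parabolicCylinder_origin_subset_slab 1 hz
    have ht' : z.1 < 0 := hz'.1
    simp only [hvan z.1 ht' z.2, zero_sub]
  have hcongr : eLpNorm (fun z : ℝ × EuclideanSpace ℝ (Fin 3) => wn z.1 z.2 - U z.1 z.2) 3
      (volume.restrict (parabolicCylinder 1 (0 : ℝ × EuclideanSpace ℝ (Fin 3)))) =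
      eLpNorm (fun z : ℝ × EuclideanSpace ℝ (Fin 3) => U z.1 z.2) 3
        (volume.restrict (parabolicCylinder 1 (0 : ℝ × EuclideanSpace ℝ (Fin 3)))) := by
    rw [eLpNorm_congr_ae (ae_restrict_of_forall_mem (isOpen_parabolicCylinder 1 _).measurableSet hEq)]
    exact eLpNorm_neg (fun z : ℝ × EuclideanSpace ℝ (Fin 3) => U z.1 z.2) 3 _
  rw [← hcongr]
  exact hclose

/-- **Given stmt-8561, the closing stub IS the sensitive Liouville statement**:
`RDSSLiouvilleInClass → (SensitiveClosing ↔ SensitiveLiouville)`. [folklore] -/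
theorem sensitiveClosing_iff_sensitiveLiouville :
    Summit.NavierStokesRegularity.NavierStokesRegularity.Theses.DulacContraction.RDSSLiouvilleInClass →
    ((∀ (u : ℝ → EuclideanSpace ℝ (Fin 3) → EuclideanSpace ℝ (Fin 3)) (p : ℝ → EuclideanSpace ℝ (Fin 3) → ℝ) (G : ℝ → EuclideanSpace ℝ (Fin 3) → EuclideanSpace ℝ (Fin 3) →L[ℝ] EuclideanSpace ℝ (Fin 3)) (C : ℝ),
       IsSuitableWeakSolutionOn (slab (EuclideanSpace ℝ (Fin 3)) (Set.Iio 0) isOpen_Iio) 1 0 u p →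
       HasWeakSpatialGradientOn (slab (EuclideanSpace ℝ (Fin 3)) (Set.Iio 0) isOpen_Iio) u G →
       typeIBound (Set.Iio (0 : ℝ) ×ˢ Set.univ) u p G < ⊤ →
       HasTypeITimeDecay C u →
       (∀ ε : ℝ, 0 < ε → ∀ K : Set (ℝ × EuclideanSpace ℝ (Fin 3)), IsCompact K → K ⊆ Set.Iic (0 : ℝ) ×ˢ Set.univ →
         ∃ L : ℝ, 0 < L ∧ ∀ a : ℝ, ∃ σ ∈ Set.Icc a (a + L),
           eLpNorm (fun z : ℝ × EuclideanSpace ℝ (Fin 3) => nsRescale (Real.exp σ) u z.1 z.2 - u z.1 z.2) 3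
             (volume.restrict K) ≤ ENNReal.ofReal ε) →
       IsBackwardSingularPoint u 0 →
       (¬ ∃ l : ℝ, 1 < l ∧ ∃ (R : EuclideanSpace ℝ (Fin 3) ≃ₗᵢ[ℝ] EuclideanSpace ℝ (Fin 3)) (ξ : EuclideanSpace ℝ (Fin 3)) (τ : ℝ), τ ≤ 0 ∧
           (fun z : ℝ × EuclideanSpace ℝ (Fin 3) => l • R.symm (u (l ^ 2 * z.1 + τ) (l • R z.2 + ξ)))
             =ᵐ[volume.restrict (Set.Iio (0 : ℝ) ×ˢ Set.univ)] (fun z : ℝ × EuclideanSpace ℝ (Fin 3) => u z.1 z.2)) →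
       (∃ δ : ℝ, 0 < δ ∧
         ∀ ε : ℝ, 0 < ε → ∀ K : Set (ℝ × EuclideanSpace ℝ (Fin 3)), IsCompact K → K ⊆ Set.Iic (0 : ℝ) ×ˢ Set.univ →
           ∃ σ : ℝ, eLpNorm (fun z : ℝ × EuclideanSpace ℝ (Fin 3) => nsRescale (Real.exp σ) u z.1 z.2 - u z.1 z.2) 3
               (volume.restrict K) ≤ ENNReal.ofReal ε ∧
             ∃ s : ℝ, ENNReal.ofReal δ < eLpNorm (fun z : ℝ × EuclideanSpace ℝ (Fin 3) =>
                 nsRescale (Real.exp σ) (nsRescale (Real.exp s) u) z.1 z.2 - nsRescale (Real.exp s) u z.1 z.2) 3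
               (volume.restrict (parabolicCylinder 1 (0 : ℝ × EuclideanSpace ℝ (Fin 3))))) →
       ∀ ε : ℝ, 0 < ε →
         ∃ (w : ℝ → EuclideanSpace ℝ (Fin 3) → EuclideanSpace ℝ (Fin 3)) (q : ℝ → EuclideanSpace ℝ (Fin 3) → ℝ) (H : ℝ → EuclideanSpace ℝ (Fin 3) → EuclideanSpace ℝ (Fin 3) →L[ℝ] EuclideanSpace ℝ (Fin 3)) (C' : ℝ),
           IsSuitableWeakSolutionOn (slab (EuclideanSpace ℝ (Fin 3)) (Set.Iio 0) isOpen_Iio) 1 0 w q ∧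
           HasWeakSpatialGradientOn (slab (EuclideanSpace ℝ (Fin 3)) (Set.Iio 0) isOpen_Iio) w H ∧
           typeIBound (Set.Iio (0 : ℝ) ×ˢ Set.univ) w q H < ⊤ ∧
           HasTypeITimeDecay C' w ∧
           IsClassicalNSSolutionOn (Set.Iio 0) 1 0 w q ∧
           (∃ l : ℝ, 1 < l ∧ ∃ R : EuclideanSpace ℝ (Fin 3) ≃ₗᵢ[ℝ] EuclideanSpace ℝ (Fin 3),
             (fun z : ℝ × EuclideanSpace ℝ (Fin 3) => l • R.symm (w (l ^ 2 * z.1) (l • R z.2)))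
               =ᵐ[volume.restrict (Set.Iio (0 : ℝ) ×ˢ Set.univ)] (fun z : ℝ × EuclideanSpace ℝ (Fin 3) => w z.1 z.2)) ∧
           eLpNorm (fun z : ℝ × EuclideanSpace ℝ (Fin 3) => w z.1 z.2 - u z.1 z.2) 3
             (volume.restrict (parabolicCylinder 1 (0 : ℝ × EuclideanSpace ℝ (Fin 3)))) ≤ ENNReal.ofReal ε) ↔
    (∀ (u : ℝ → EuclideanSpace ℝ (Fin 3) → EuclideanSpace ℝ (Fin 3)) (p : ℝ → EuclideanSpace ℝ (Fin 3) → ℝ) (G : ℝ → EuclideanSpace ℝ (Fin 3) → EuclideanSpace ℝ (Fin 3) →L[ℝ] EuclideanSpace ℝ (Fin 3)) (C : ℝ),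
       IsSuitableWeakSolutionOn (slab (EuclideanSpace ℝ (Fin 3)) (Set.Iio 0) isOpen_Iio) 1 0 u p →
       HasWeakSpatialGradientOn (slab (EuclideanSpace ℝ (Fin 3)) (Set.Iio 0) isOpen_Iio) u G →
       typeIBound (Set.Iio (0 : ℝ) ×ˢ Set.univ) u p G < ⊤ →
       HasTypeITimeDecay C u →
       (∀ ε : ℝ, 0 < ε → ∀ K : Set (ℝ × EuclideanSpace ℝ (Fin 3)), IsCompact K → K ⊆ Set.Iic (0 : ℝ) ×ˢ Set.univ →
         ∃ L : ℝ, 0 < L ∧ ∀ a : ℝ, ∃ σ ∈ Set.Icc a (a + L),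
           eLpNorm (fun z : ℝ × EuclideanSpace ℝ (Fin 3) => nsRescale (Real.exp σ) u z.1 z.2 - u z.1 z.2) 3
             (volume.restrict K) ≤ ENNReal.ofReal ε) →
       (¬ ∃ l : ℝ, 1 < l ∧ ∃ (R : EuclideanSpace ℝ (Fin 3) ≃ₗᵢ[ℝ] EuclideanSpace ℝ (Fin 3)) (ξ : EuclideanSpace ℝ (Fin 3)) (τ : ℝ), τ ≤ 0 ∧
           (fun z : ℝ × EuclideanSpace ℝ (Fin 3) => l • R.symm (u (l ^ 2 * z.1 + τ) (l • R z.2 + ξ)))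
             =ᵐ[volume.restrict (Set.Iio (0 : ℝ) ×ˢ Set.univ)] (fun z : ℝ × EuclideanSpace ℝ (Fin 3) => u z.1 z.2)) →
       (∃ δ : ℝ, 0 < δ ∧
         ∀ ε : ℝ, 0 < ε → ∀ K : Set (ℝ × EuclideanSpace ℝ (Fin 3)), IsCompact K → K ⊆ Set.Iic (0 : ℝ) ×ˢ Set.univ →
           ∃ σ : ℝ, eLpNorm (fun z : ℝ × EuclideanSpace ℝ (Fin 3) => nsRescale (Real.exp σ) u z.1 z.2 - u z.1 z.2) 3
               (volume.restrict K) ≤ ENNReal.ofReal ε ∧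
             ∃ s : ℝ, ENNReal.ofReal δ < eLpNorm (fun z : ℝ × EuclideanSpace ℝ (Fin 3) =>
                 nsRescale (Real.exp σ) (nsRescale (Real.exp s) u) z.1 z.2 - nsRescale (Real.exp s) u z.1 z.2) 3
               (volume.restrict (parabolicCylinder 1 (0 : ℝ × EuclideanSpace ℝ (Fin 3))))) →
       ¬ IsBackwardSingularPoint u 0)) :=
  fun h8561 => ⟨sensitiveLiouville_of_sensitiveClosing h8561, sensitiveClosing_of_sensitiveLiouville⟩

/-- **THREE LIOUVILLE THEOREMS (registered sub-goal): `ForcedSymmetry ↔ (SensitiveLiouville ∧ AlmostPeriodicLiouville ∧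
RDSSLiouvilleInClass)`** — the crux is exactly the conjunction of three Liouville statements for Type-I slab class profiles with
pairwise disjoint refutation witnesses: a sensitive aperiodic uniformly recurrent singular hull / a quasi-periodically
self-similar singular profile / a rotated-discretely self-similar singular profile.  From `forcedSymmetry_iff_closingDichotomyParts`
(p155228) and `sensitiveClosing_iff_sensitiveLiouville`. [cite: AlbrittonBarker2019, Thm 1.1, §3; AuslanderYorke1980, Thm 1] -/
theorem forcedSymmetry_iff_liouvilleParts :
    Summit.NavierStokesRegularity.NavierStokesRegularity.Theses.SymmetryModuliCount.ForcedSymmetry ↔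
    ((∀ (u : ℝ → EuclideanSpace ℝ (Fin 3) → EuclideanSpace ℝ (Fin 3)) (p : ℝ → EuclideanSpace ℝ (Fin 3) → ℝ) (G : ℝ → EuclideanSpace ℝ (Fin 3) → EuclideanSpace ℝ (Fin 3) →L[ℝ] EuclideanSpace ℝ (Fin 3)) (C : ℝ),
       IsSuitableWeakSolutionOn (slab (EuclideanSpace ℝ (Fin 3)) (Set.Iio 0) isOpen_Iio) 1 0 u p →
       HasWeakSpatialGradientOn (slab (EuclideanSpace ℝ (Fin 3)) (Set.Iio 0) isOpen_Iio) u G →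
       typeIBound (Set.Iio (0 : ℝ) ×ˢ Set.univ) u p G < ⊤ →
       HasTypeITimeDecay C u →
       (∀ ε : ℝ, 0 < ε → ∀ K : Set (ℝ × EuclideanSpace ℝ (Fin 3)), IsCompact K → K ⊆ Set.Iic (0 : ℝ) ×ˢ Set.univ →
         ∃ L : ℝ, 0 < L ∧ ∀ a : ℝ, ∃ σ ∈ Set.Icc a (a + L),
           eLpNorm (fun z : ℝ × EuclideanSpace ℝ (Fin 3) => nsRescale (Real.exp σ) u z.1 z.2 - u z.1 z.2) 3
             (volume.restrict K) ≤ ENNReal.ofReal ε) →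
       (¬ ∃ l : ℝ, 1 < l ∧ ∃ (R : EuclideanSpace ℝ (Fin 3) ≃ₗᵢ[ℝ] EuclideanSpace ℝ (Fin 3)) (ξ : EuclideanSpace ℝ (Fin 3)) (τ : ℝ), τ ≤ 0 ∧
           (fun z : ℝ × EuclideanSpace ℝ (Fin 3) => l • R.symm (u (l ^ 2 * z.1 + τ) (l • R z.2 + ξ)))
             =ᵐ[volume.restrict (Set.Iio (0 : ℝ) ×ˢ Set.univ)] (fun z : ℝ × EuclideanSpace ℝ (Fin 3) => u z.1 z.2)) →
       (∃ δ : ℝ, 0 < δ ∧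
         ∀ ε : ℝ, 0 < ε → ∀ K : Set (ℝ × EuclideanSpace ℝ (Fin 3)), IsCompact K → K ⊆ Set.Iic (0 : ℝ) ×ˢ Set.univ →
           ∃ σ : ℝ, eLpNorm (fun z : ℝ × EuclideanSpace ℝ (Fin 3) => nsRescale (Real.exp σ) u z.1 z.2 - u z.1 z.2) 3
               (volume.restrict K) ≤ ENNReal.ofReal ε ∧
             ∃ s : ℝ, ENNReal.ofReal δ < eLpNorm (fun z : ℝ × EuclideanSpace ℝ (Fin 3) =>
                 nsRescale (Real.exp σ) (nsRescale (Real.exp s) u) z.1 z.2 - nsRescale (Real.exp s) u z.1 z.2) 3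
               (volume.restrict (parabolicCylinder 1 (0 : ℝ × EuclideanSpace ℝ (Fin 3))))) →
       ¬ IsBackwardSingularPoint u 0) ∧
    (∀ (u : ℝ → EuclideanSpace ℝ (Fin 3) → EuclideanSpace ℝ (Fin 3)) (p : ℝ → EuclideanSpace ℝ (Fin 3) → ℝ) (G : ℝ → EuclideanSpace ℝ (Fin 3) → EuclideanSpace ℝ (Fin 3) →L[ℝ] EuclideanSpace ℝ (Fin 3)) (C : ℝ),
       IsSuitableWeakSolutionOn (slab (EuclideanSpace ℝ (Fin 3)) (Set.Iio 0) isOpen_Iio) 1 0 u p →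
       HasWeakSpatialGradientOn (slab (EuclideanSpace ℝ (Fin 3)) (Set.Iio 0) isOpen_Iio) u G →
       typeIBound (Set.Iio (0 : ℝ) ×ˢ Set.univ) u p G < ⊤ →
       HasTypeITimeDecay C u →
       (∀ ε : ℝ, 0 < ε → ∀ K : Set (ℝ × EuclideanSpace ℝ (Fin 3)), IsCompact K → K ⊆ Set.Iic (0 : ℝ) ×ˢ Set.univ →
         ∃ L : ℝ, 0 < L ∧ ∀ a : ℝ, ∃ σ ∈ Set.Icc a (a + L), ∀ s : ℝ,
           eLpNorm (fun z : ℝ × EuclideanSpace ℝ (Fin 3) =>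
               nsRescale (Real.exp σ) (nsRescale (Real.exp s) u) z.1 z.2 - nsRescale (Real.exp s) u z.1 z.2) 3
             (volume.restrict K) ≤ ENNReal.ofReal ε) →
       (¬ ∃ l : ℝ, 1 < l ∧ ∃ (R : EuclideanSpace ℝ (Fin 3) ≃ₗᵢ[ℝ] EuclideanSpace ℝ (Fin 3)) (ξ : EuclideanSpace ℝ (Fin 3)) (τ : ℝ), τ ≤ 0 ∧
           (fun z : ℝ × EuclideanSpace ℝ (Fin 3) => l • R.symm (u (l ^ 2 * z.1 + τ) (l • R z.2 + ξ)))
             =ᵐ[volume.restrict (Set.Iio (0 : ℝ) ×ˢ Set.univ)] (fun z : ℝ × EuclideanSpace ℝ (Fin 3) => u z.1 z.2)) →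
       ¬ IsBackwardSingularPoint u 0) ∧
    Summit.NavierStokesRegularity.NavierStokesRegularity.Theses.DulacContraction.RDSSLiouvilleInClass) := by
  rw [forcedSymmetry_iff_closingDichotomyParts]
  constructor
  · rintro ⟨hSC, hAPL, h8561⟩
    exact ⟨sensitiveLiouville_of_sensitiveClosing h8561 hSC, hAPL, h8561⟩
  · rintro ⟨hSL, hAPL, h8561⟩
    exact ⟨sensitiveClosing_of_sensitiveLiouville hSL, hAPL, h8561⟩

end Summit.NavierStokesRegularity.NavierStokesRegularity.Theorems.SymmetryModuliCountForcedSymmetry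

end
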